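import Literature.Analysis.ValidatedNumerics.ExpPoly.CorrelationCert
import HarnessLib

/-!
# RiemannHypothesis / GroundBarta — rung 4 (`EvenWinsBeyondArch`): A-layer infrastructure —
# the increment identity by interpolation WITHOUT the kernel length check of `Poly.corr`

Helper file (`--supports stmt-RiemannHypothesis-18085`), RH-free, Mathlib + landed tree files only, no definitions,
no named facts.  Prover A (gen 4 of unit `sr-gb-rung-a`).

`Poly.inc_identity_of_checks_nat` (Literature `ExpPoly/CorrelationCert`) certifies the increment polynomial `E` of a
window vector against `L` point checks, given the two length hypotheses `E.length + 2 ≤ L` and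
`(Poly.corr p p b).length + 1 ≤ L`.  The second one is discharged in the generated data files by `decide +kernel` on
the spine of the bivariate correlation list — which the kernel evaluates within budget at degree `55` but not at degree
`83`/`97` ("excessive memory consumption", measured 2026-08-20), the degrees the parity-ladder cell `[3/4, 39/50]` needs.

This file removes that hypothesis: the correlation `t ↦ ∫_{-b}^{b-t} p(x+t) p(x) dx` is a polynomial function of
degree `≤ 2·|p| − 1` (`dt_exists_corrPoly`: explicit expansion, its evaluation and degree), so the
interpolation argument runs with `2·|p| ≤ L` instead (`dt_inc_identity_of_checks_deg`, `…_nat_deg`) — a hypothesis that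
`decide` settles on the length of the coefficient list `p` alone.
-/

set_option linter.dupNamespace false

noncomputable section

open Real MeasureTheory intervalIntegral Polynomial Finset
open scoped BigOperators

namespace Summit.RiemannHypothesis.RiemannHypothesis.Theorems.EvenWinsBeyondArch

open Literature.Analysis.ValidatedNumerics Literature.Analysis.ValidatedNumerics.ExpPoly
open Literature.Analysis.ValidatedNumerics.ExpPoly.Poly

/-- Degree of one term of the explicit correlation polynomial:
`natDegree (c · X^{i-m} · ((b − X)^{m+j+1} − (−b)^{m+j+1})) ≤ i + j + 1` for `m ≤ i`. [folklore] -/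
theorem dt_natDegree_corrTerm_le (c b : ℝ) (i j m : ℕ) (hm : m ≤ i) :
    (C c * (X ^ (i - m) * ((C b - X) ^ (m + j + 1) - C ((-b) ^ (m + j + 1)))) : ℝ[X]).natDegree ≤ i + j + 1 := by
  have h1 : (X ^ (i - m) : ℝ[X]).natDegree ≤ i - m := natDegree_X_pow_le (i - m)
  have hbx : (C b - X : ℝ[X]).natDegree ≤ 1 := by
    refine (natDegree_sub_le _ _).trans ?_
    rw [natDegree_C, natDegree_X]; simp
  have h2 : ((C b - X) ^ (m + j + 1) : ℝ[X]).natDegree ≤ m + j + 1 := by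
    refine natDegree_pow_le.trans ?_
    calc (m + j + 1) * (C b - X : ℝ[X]).natDegree ≤ (m + j + 1) * 1 := Nat.mul_le_mul_left _ hbx
      _ = m + j + 1 := by ring
  have h3 : (((C b - X) ^ (m + j + 1) - C ((-b) ^ (m + j + 1))) : ℝ[X]).natDegree ≤ m + j + 1 := by
    refine (natDegree_sub_le _ _).trans ?_
    rw [natDegree_C]; exact max_le h2 (Nat.zero_le _)
  have h4 : (X ^ (i - m) * ((C b - X) ^ (m + j + 1) - C ((-b) ^ (m + j + 1))) : ℝ[X]).natDegree ≤ i + j + 1 := by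
    refine natDegree_mul_le.trans ?_
    omega
  exact (natDegree_C_mul_le _ _).trans h4

/-- `∫_α^β (x+s)^i x^j dx = Σ_{m ≤ i} C(i,m) s^{i-m} (β^{m+j+1} − α^{m+j+1})/(m+j+1)`. [folklore] -/
theorem dt_integral_addPow_mul_pow (s α β : ℝ) (i j : ℕ) :
    ∫ x in α..β, (x + s) ^ i * x ^ j =
      ∑ m ∈ range (i + 1), (i.choose m : ℝ) * s ^ (i - m) * ((β ^ (m + j + 1) - α ^ (m + j + 1)) / ((m + j + 1 : ℕ) : ℝ)) := by
  have hexp : ∀ x : ℝ, (x + s) ^ i * x ^ j =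
      ∑ m ∈ range (i + 1), (i.choose m : ℝ) * s ^ (i - m) * x ^ (m + j) := by
    intro x
    rw [add_pow, sum_mul]
    refine sum_congr rfl fun m _ ↦ ?_
    rw [pow_add]; ring
  simp_rw [hexp]
  have hI : ∀ m ∈ range (i + 1), IntervalIntegrable (fun x : ℝ ↦ (i.choose m : ℝ) * s ^ (i - m) * x ^ (m + j))
      volume α β :=
    fun m _ ↦ Continuous.intervalIntegrable (by fun_prop) _ _
  rw [intervalIntegral.integral_finsetSum hI]
  refine sum_congr rfl fun m _ ↦ ?_
  rw [intervalIntegral.integral_const_mul, integral_pow]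
  push_cast
  ring

/-- **The correlation is a polynomial of degree `≤ 2|p| − 1`.**  For a coefficient list `p` and a rational `b` there is
a real polynomial `Q` with `natDegree Q ≤ 2|p| − 1` and `Q(s) = ∫_{-b}^{b-s} p(x+s) p(x) dx` for every real `s`
(explicitly `Q = Σ_{i,j<|p|} Σ_{m≤i} p_i p_j C(i,m)/(m+j+1) · X^{i-m}((b − X)^{m+j+1} − (−b)^{m+j+1})`). [folklore] -/
theorem dt_exists_corrPoly (p : Poly) (b : ℚ) : ∃ Q : ℝ[X], Q.natDegree ≤ 2 * p.length - 1 ∧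
    ∀ s : ℝ, Q.eval s = ∫ x in (-(b : ℝ))..((b : ℝ) - s), eval p (x + s) * eval p x := by
  refine ⟨∑ i ∈ range p.length, ∑ j ∈ range p.length, ∑ m ∈ range (i + 1),
    C (((p.getD i 0 : ℚ) : ℝ) * ((p.getD j 0 : ℚ) : ℝ) * (i.choose m : ℝ) / ((m + j + 1 : ℕ) : ℝ)) *
      (X ^ (i - m) * ((C (b : ℝ) - X) ^ (m + j + 1) - C ((-(b : ℝ)) ^ (m + j + 1)))), ?_, fun s ↦ ?_⟩
  · refine natDegree_sum_le_of_forall_le _ _ fun i hi ↦ ?_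
    refine natDegree_sum_le_of_forall_le _ _ fun j hj ↦ ?_
    refine natDegree_sum_le_of_forall_le _ _ fun m hm ↦ ?_
    have hi' := mem_range.1 hi; have hj' := mem_range.1 hj; have hm' := mem_range.1 hm
    exact (dt_natDegree_corrTerm_le _ (b : ℝ) i j m (by omega)).trans (by omega)
  -- both sides equal the same double sum
  have hint : ∀ x : ℝ, eval p (x + s) * eval p x =
      ∑ i ∈ range p.length, ∑ j ∈ range p.length,
        ((p.getD i 0 : ℚ) : ℝ) * ((p.getD j 0 : ℚ) : ℝ) * ((x + s) ^ i * x ^ j) := by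
    intro x
    rw [eval_eq_sum_getD p (x + s), eval_eq_sum_getD p x, sum_mul_sum]
    refine sum_congr rfl fun i _ ↦ sum_congr rfl fun j _ ↦ ?_
    ring
  have hcont : ∀ i j : ℕ, Continuous (fun x : ℝ ↦
      ((p.getD i 0 : ℚ) : ℝ) * ((p.getD j 0 : ℚ) : ℝ) * ((x + s) ^ i * x ^ j)) :=
    fun i j ↦ by fun_prop
  have hI1 : ∀ i ∈ range p.length, IntervalIntegrable (fun x : ℝ ↦ ∑ j ∈ range p.length,
      ((p.getD i 0 : ℚ) : ℝ) * ((p.getD j 0 : ℚ) : ℝ) * ((x + s) ^ i * x ^ j)) volume (-(b : ℝ)) ((b : ℝ) - s) :=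
    fun i _ ↦ Continuous.intervalIntegrable (continuous_finsetSum _ (fun j _ ↦ hcont i j)) _ _
  have hI2 : ∀ i : ℕ, ∀ j ∈ range p.length, IntervalIntegrable (fun x : ℝ ↦
      ((p.getD i 0 : ℚ) : ℝ) * ((p.getD j 0 : ℚ) : ℝ) * ((x + s) ^ i * x ^ j)) volume (-(b : ℝ)) ((b : ℝ) - s) :=
    fun i j _ ↦ (hcont i j).intervalIntegrable _ _
  have hrhs : ∫ x in (-(b : ℝ))..((b : ℝ) - s), eval p (x + s) * eval p x =
      ∑ i ∈ range p.length, ∑ j ∈ range p.length,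
        ((p.getD i 0 : ℚ) : ℝ) * ((p.getD j 0 : ℚ) : ℝ) *
          ∑ m ∈ range (i + 1), (i.choose m : ℝ) * s ^ (i - m) *
            ((((b : ℝ) - s) ^ (m + j + 1) - (-(b : ℝ)) ^ (m + j + 1)) / ((m + j + 1 : ℕ) : ℝ)) := by
    simp_rw [hint]
    rw [intervalIntegral.integral_finsetSum hI1]
    refine sum_congr rfl fun i _ ↦ ?_
    rw [intervalIntegral.integral_finsetSum (hI2 i)]
    refine sum_congr rfl fun j _ ↦ ?_
    rw [intervalIntegral.integral_const_mul, dt_integral_addPow_mul_pow]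
  rw [hrhs, Polynomial.eval_finsetSum]
  refine sum_congr rfl fun i _ ↦ ?_
  rw [Polynomial.eval_finsetSum]
  refine sum_congr rfl fun j _ ↦ ?_
  rw [Polynomial.eval_finsetSum, mul_sum]
  refine sum_congr rfl fun m _ ↦ ?_
  simp only [Polynomial.eval_mul, Polynomial.eval_C, Polynomial.eval_pow, Polynomial.eval_X, Polynomial.eval_sub]
  ring

/-- **Certification of an increment polynomial by interpolation, degree form.**  As
`Poly.inc_identity_of_checks` but with the kernel-expensive hypothesis `(corr p p b).length + 1 ≤ L` replaced by
`2·|p| ≤ L` (the correlation polynomial has degree `≤ 2|p| − 1`, `dt_exists_corrPoly`). [folklore] -/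
theorem dt_inc_identity_of_checks_deg (p E : Poly) (b : ℚ) {L : ℕ} (hLE : E.length + 2 ≤ L)
    (hLp : 2 * p.length ≤ L) (ts : Fin L → ℚ) (hts : Function.Injective ts)
    (hchk : ∀ j : Fin L, incCheckAt p E b (ts j) = true) (t : ℝ) :
    t * eval E t = eval (smul 2 (corr p p b)) 0 - eval (smul 2 (corr p p b)) t := by
  obtain ⟨Q, hQdeg, hQev⟩ := dt_exists_corrPoly p b
  set d : Poly := smul 2 (corr p p b) with hd
  have hevd : ∀ s : ℝ, eval d s = 2 * Q.eval s := by
    intro s; rw [hd, eval_smul, eval_corr, hQev]; push_cast; ring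
  set P1 : ℝ[X] := X * PolyMP.toPoly (E.map ((↑) : ℚ → ℝ)) with hP1
  set P2 : ℝ[X] := C (eval d 0) - C 2 * Q with hP2
  have hev1 : ∀ s : ℝ, P1.eval s = s * eval E s := by
    intro s; rw [hP1, Polynomial.eval_mul, Polynomial.eval_X, PolyMP.eval_toPoly, ← eval_eq_evalR]
  have hev2 : ∀ s : ℝ, P2.eval s = eval d 0 - eval d s := by
    intro s; rw [hP2, Polynomial.eval_sub, Polynomial.eval_C, Polynomial.eval_mul, Polynomial.eval_C, hevd s]
  -- degrees
  have hdeg1 : P1.natDegree < L := by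
    have h1 : (PolyMP.toPoly (E.map ((↑) : ℚ → ℝ))).natDegree ≤ E.length := by
      simpa using PolyMP.natDegree_toPoly_le_length (E.map ((↑) : ℚ → ℝ))
    have hX : (X : ℝ[X]).natDegree ≤ 1 := Polynomial.natDegree_X_le
    have hmul : P1.natDegree ≤ (X : ℝ[X]).natDegree + (PolyMP.toPoly (E.map ((↑) : ℚ → ℝ))).natDegree :=
      Polynomial.natDegree_mul_le
    omega
  have hdeg2 : P2.natDegree < L := by
    have h2 : (C 2 * Q : ℝ[X]).natDegree ≤ 2 * p.length - 1 := (natDegree_C_mul_le _ _).trans hQdeg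
    calc P2.natDegree ≤ max (C (eval d 0) : ℝ[X]).natDegree (C 2 * Q : ℝ[X]).natDegree :=
          Polynomial.natDegree_sub_le _ _
      _ ≤ 2 * p.length - 1 := by rw [Polynomial.natDegree_C]; exact max_le (Nat.zero_le _) h2
      _ < L := by omega
  -- agreement at the nodes
  have hinj : Function.Injective (fun j : Fin L ↦ ((ts j : ℚ) : ℝ)) := by
    intro i j hij
    have hij' : ((ts i : ℚ) : ℝ) = ((ts j : ℚ) : ℝ) := hij
    exact hts (by exact_mod_cast hij')
  have heval : ∀ j : Fin L, P1.eval ((ts j : ℚ) : ℝ) = P2.eval ((ts j : ℚ) : ℝ) := by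
    intro j
    have hc := hchk j
    unfold incCheckAt at hc
    have hq : (ts j : ℚ) * evalQ E (ts j) = 2 * corrAt p b 0 - 2 * corrAt p b (ts j) := of_decide_eq_true hc
    have hr : ((ts j : ℚ) : ℝ) * eval E (ts j) = 2 * ((corrAt p b 0 : ℚ) : ℝ) - 2 * ((corrAt p b (ts j) : ℚ) : ℝ) := by
      rw [← eval_evalQ]; exact_mod_cast hq
    rw [hev1, hev2, hr, corrAt_eq, corrAt_eq, hd, eval_smul, eval_smul]
    push_cast
    ring
  have hcard : max P1.natDegree P2.natDegree < Fintype.card (Fin L) := by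
    rw [Fintype.card_fin]; exact max_lt hdeg1 hdeg2
  have hPQ := Polynomial.eq_of_natDegree_lt_card_of_eval_eq P1 P2 hinj heval hcard
  have := congrArg (fun P : ℝ[X] ↦ P.eval t) hPQ
  simp only [hev1, hev2] at this
  exact this

/-- **ℕ-indexed degree form** (nodes `ts j`, `j < L`, pairwise distinct) — the shape used by the generated A-layer
files of the cell `[3/4, 39/50]` (`interval_cases`), with `2·|p| ≤ L` by `decide`. [folklore] -/
theorem dt_inc_identity_of_checks_nat_deg (p E : Poly) (b : ℚ) {L : ℕ} (hLE : E.length + 2 ≤ L)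
    (hLp : 2 * p.length ≤ L) (ts : ℕ → ℚ) (hts : ∀ i j, i < L → j < L → ts i = ts j → i = j)
    (hchk : ∀ j, j < L → incCheckAt p E b (ts j) = true) (t : ℝ) :
    t * eval E t = eval (smul 2 (corr p p b)) 0 - eval (smul 2 (corr p p b)) t :=
  dt_inc_identity_of_checks_deg p E b hLE hLp (fun j : Fin L => ts j)
    (fun i j h => Fin.ext (hts i j i.isLt j.isLt h)) (fun j => hchk j j.isLt) t

end Summit.RiemannHypothesis.RiemannHypothesis.Theorems.EvenWinsBeyondArch

end
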